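import Literature.NumberTheory.Multiplicative.SigmaParity
import Mathlib.Data.Nat.Squarefree
import Mathlib.Data.ZMod.Basic
import Mathlib.RingTheory.PowerSeries.Basic
import HarnessLib

/-!
# Route `EisensteinDepletionAtTwo`, crux E1M `DepletedLambdaLawAtTwoMod` (stmt-BirchSwinnertonDyer-20341), line `star`,
# research stub `stub_starSymbGlobal` (R1): the ELEMENTARY CORE of the `η`-parity lemma

Cell `bsd-rank2`, seat `bsd-rank2-eng-2` GEN 11; helper `--supports stmt-BirchSwinnertonDyer-20341`.  HONEST FRAMING:
elementary number theory + bookkeeping in `𝔽₂⟦q⟧`; nothing here reads an analytic rank, nothing here proves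
(★-SymbGlobal) / E1M; BSD is not proved by any of this (PARTITION D-0054: none — r_an ≥ 2 axis S0, door T-r3₂).

## What this serves

Planner bsd-rank2-p2 GEN 22's reduction of R1 = `stub_starSymbGlobal` at composite B-type levels
(`run/shared/lean/pub/bsd-rank2/p2/g22/R1-placement.md` §8.11–8.12) rests on the **`η`-parity lemma**: for an odd squarefree
level `N` and a modular unit `u = ∏_{d ∣ N} η(dτ)^{r_d}`, the cuspidal `2`-torsion class `[½ div u]` is multiplicative at
`2` iff every `r_d` is even (iff it is a Shimura class).  Its proof: `x̄ = 0 ⟺ ū` is a square in `𝔽₂(X₀(N)) ⟺ q dū/ū = 0`,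
and mod `2`
  `q u'/u = Σ_d d r_d/24 − Σ_d r_d · Σ_{n ≥ 1} d n q^{dn}/(1 − q^{dn})`,  `Σ_n d n q^{dn}/(1 − q^{dn}) = Σ_m d σ(m/d)[d ∣ m] q^m`,
so (for odd `d`) each Lambert series reduces mod `2` to `θ_d := Σ_{k ≥ 1} (q^{d k²} + q^{2 d k²})` because
**`σ(n)` is odd iff `n` is a square or twice a square** (tree: `Literature.NumberTheory.Multiplicative.SigmaParity`,
Honsberger *Math. Gems I* Ch. 10 Ex. 4), and `q u'/u ≡ const + Σ_{r_d odd} θ_d` vanishes iff no `r_d` is odd because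
**the supports `S_d = {d k², 2 d k²}` are pairwise disjoint for distinct odd squarefree `d`**.  This file proves exactly
these two elementary inputs in the tree's vocabulary (the function-field step and Ligozat's criterion are NOT here):

* `sq_or_twice_sq_iff_odd_sigma` — `m = d k²` or `2 d k²` (`k ≥ 1`) iff `d ∣ m`, `m ≠ 0`, `σ(m/d)` odd (`d ≠ 0`):
  `θ_d` IS the mod-`2` Lambert series of `σ` at the multiples of `d`;
* `eq_of_sq_or_twice_sq_eq` — **disjointness**: `2^ε d k² = 2^{ε'} d' k'²` (`ε, ε' ≤ 1`, `k, k' ≥ 1`, `d, d'` odd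
  squarefree) forces `d = d'` (invariant: the set of odd primes with odd exponent);
* `even_of_sum_smul_indicator_eq_C` — a general independence lemma in `R⟦q⟧` for indicator series of sets `S i`
  with marked elements `e i ∈ S i`, `e i ∉ S j` (`i ≠ j`), `e i ≥ 1`;
* **`even_of_sum_smul_theta_eq_C`**, `sum_smul_theta_eq_C_iff` — for a finite set `D` of odd squarefree numbers and
  multiplicities `r : ℕ → ℤ`: `Σ_{d ∈ D} r_d θ_d` is a constant in `𝔽₂⟦q⟧` iff every `r_d` is even.
-/

-- `Summit.BirchSwinnertonDyer.BirchSwinnertonDyer.…` (single-conjunct summit, Sub = Summit) trips the linter by design.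
set_option linter.dupNamespace false
set_option autoImplicit false

open Finset ArithmeticFunction
open scoped ArithmeticFunction.sigma

namespace Summit.BirchSwinnertonDyer.BirchSwinnertonDyer.Theorems.DepletionAtTwo

open Literature.NumberTheory.Multiplicative.SigmaParity

/-! ### 1. `S_d = {d k², 2 d k² : k ≥ 1}` and the parity of `σ` -/

/-- **`θ_d` is the mod-`2` Lambert series of `σ`.**  For `d ≠ 0`: `m` is of the form `d k²` or `2 d k²` with
`k ≥ 1` iff `d ∣ m`, `m ≠ 0` and `σ(m/d)` is odd (Honsberger Ch. 10 Ex. 4 via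
`Literature.NumberTheory.Multiplicative.SigmaParity.odd_sigma_one_iff'`). -/
theorem sq_or_twice_sq_iff_odd_sigma {d m : ℕ} (hd : d ≠ 0) :
    (∃ k, k ≠ 0 ∧ (m = d * k ^ 2 ∨ m = 2 * (d * k ^ 2))) ↔ d ∣ m ∧ m ≠ 0 ∧ Odd (σ 1 (m / d)) := by
  constructor
  · rintro ⟨k, hk, rfl | rfl⟩
    · refine ⟨dvd_mul_right _ _, by positivity, ?_⟩
      rw [Nat.mul_div_cancel_left _ hd.bot_lt, odd_sigma_one_iff' (pow_ne_zero _ hk)]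
      exact ⟨k, Or.inl rfl⟩
    · refine ⟨Dvd.dvd.mul_left (dvd_mul_right _ _) _, by positivity, ?_⟩
      rw [show 2 * (d * k ^ 2) = d * (2 * k ^ 2) by ring, Nat.mul_div_cancel_left _ hd.bot_lt,
        odd_sigma_one_iff' (by positivity)]
      exact ⟨k, Or.inr rfl⟩
  · rintro ⟨⟨e, rfl⟩, hm, hodd⟩
    rw [Nat.mul_div_cancel_left _ hd.bot_lt] at hodd
    have he : e ≠ 0 := by rintro rfl; exact hm (by simp)
    obtain ⟨k, hk⟩ := (odd_sigma_one_iff' he).mp hodd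
    have hk0 : k ≠ 0 := by
      rintro rfl
      rcases hk with rfl | rfl <;> simp at he
    rcases hk with rfl | rfl
    · exact ⟨k, hk0, Or.inl rfl⟩
    · exact ⟨k, hk0, Or.inr (by ring)⟩

/-! ### 2. Disjointness of the supports `S_d` -/

/-- The invariant separating the `S_d` is the finset of ODD primes occurring in `m` to an ODD power,
`m.primeFactors.filter (p ≠ 2 ∧ Odd (v_p m))` (kept inline — no definition).  Multiplying by a nonzero square
does not change it. -/
private theorem oddOddPrimes_mul_sq {m k : ℕ} (hm : m ≠ 0) (hk : k ≠ 0) :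
    (m * k ^ 2).primeFactors.filter (fun p ↦ p ≠ 2 ∧ Odd ((m * k ^ 2).factorization p)) =
      m.primeFactors.filter (fun p ↦ p ≠ 2 ∧ Odd (m.factorization p)) := by
  ext p
  simp only [Finset.mem_filter, Nat.mem_primeFactors, ne_eq, mul_eq_zero, hm, hk, pow_eq_zero_iff,
    OfNat.ofNat_ne_zero, not_false_eq_true, or_self, and_true, Nat.factorization_mul hm
    (pow_ne_zero 2 hk), Nat.factorization_pow, Finsupp.add_apply, Finsupp.smul_apply, smul_eq_mul]
  constructor
  · rintro ⟨⟨hp, -⟩, hp2, hodd⟩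
    have hodd' : Odd (m.factorization p) := by
      rcases (m.factorization p).even_or_odd with he | ho
      · exact absurd (he.add (even_two_mul _)) (Nat.not_even_iff_odd.mpr hodd)
      · exact ho
    refine ⟨⟨hp, ?_⟩, hp2, hodd'⟩
    exact Nat.dvd_of_factorization_pos fun h0 ↦ by
      rw [h0] at hodd'; exact Nat.not_odd_zero hodd'
  · rintro ⟨⟨hp, hpm⟩, hp2, hodd⟩
    exact ⟨⟨hp, hpm.mul_right _⟩, hp2, hodd.add_even (even_two_mul _)⟩

/-- Multiplying by `2` does not change the invariant. -/
private theorem oddOddPrimes_two_mul {m : ℕ} (hm : m ≠ 0) :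
    (2 * m).primeFactors.filter (fun p ↦ p ≠ 2 ∧ Odd ((2 * m).factorization p)) =
      m.primeFactors.filter (fun p ↦ p ≠ 2 ∧ Odd (m.factorization p)) := by
  ext p
  simp only [Finset.mem_filter, Nat.mem_primeFactors, ne_eq, mul_eq_zero, OfNat.ofNat_ne_zero, hm,
    or_self, not_false_eq_true, and_true]
  constructor
  · rintro ⟨⟨hp, h2m⟩, hp2, hodd⟩
    rw [show 2 * m = 2 ^ 1 * m by ring, factorization_two_pow_mul_of_ne_two hm hp2] at hodd
    refine ⟨⟨hp, ?_⟩, hp2, hodd⟩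
    exact (Nat.Coprime.dvd_of_dvd_mul_left
      ((Nat.coprime_primes hp Nat.prime_two).mpr hp2) h2m)
  · rintro ⟨⟨hp, hpm⟩, hp2, hodd⟩
    refine ⟨⟨hp, hpm.mul_left _⟩, hp2, ?_⟩
    rwa [show 2 * m = 2 ^ 1 * m by ring, factorization_two_pow_mul_of_ne_two hm hp2]

/-- Multiplying by `2^ε`, `ε ≤ 1`, does not change the invariant. -/
private theorem oddOddPrimes_two_pow_mul {m ε : ℕ} (hm : m ≠ 0) (hε : ε ≤ 1) :
    (2 ^ ε * m).primeFactors.filter (fun p ↦ p ≠ 2 ∧ Odd ((2 ^ ε * m).factorization p)) =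
      m.primeFactors.filter (fun p ↦ p ≠ 2 ∧ Odd (m.factorization p)) := by
  interval_cases ε
  · simp only [pow_zero, one_mul]
  · rw [pow_one, oddOddPrimes_two_mul hm]

/-- For an odd squarefree `d` the invariant is the whole set of prime factors of `d`. -/
private theorem oddOddPrimes_of_odd_squarefree {d : ℕ} (hodd : Odd d) (hsf : Squarefree d) :
    d.primeFactors.filter (fun p ↦ p ≠ 2 ∧ Odd (d.factorization p)) = d.primeFactors := by
  ext p
  simp only [Finset.mem_filter, and_iff_left_iff_imp]
  intro hp
  have hpp := Nat.prime_of_mem_primeFactors hp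
  have hpd := Nat.dvd_of_mem_primeFactors hp
  refine ⟨?_, ?_⟩
  · rintro rfl
    exact hodd.not_two_dvd_nat hpd
  · have h1 : d.factorization p ≤ 1 := (Nat.squarefree_iff_factorization_le_one hsf.ne_zero).mp hsf p
    have h0 : 0 < d.factorization p := hpp.factorization_pos_of_dvd hsf.ne_zero hpd
    have : d.factorization p = 1 := le_antisymm h1 h0
    rw [this]
    exact odd_one

/-- On the whole of `S_d` (and its `2^ε`-variants) the invariant is `d.primeFactors`. -/
private theorem oddOddPrimes_two_pow_mul_mul_sq {d k ε : ℕ} (hodd : Odd d) (hsf : Squarefree d)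
    (hk : k ≠ 0) (hε : ε ≤ 1) :
    (2 ^ ε * (d * k ^ 2)).primeFactors.filter (fun p ↦ p ≠ 2 ∧ Odd ((2 ^ ε * (d * k ^ 2)).factorization p)) =
      d.primeFactors := by
  rw [oddOddPrimes_two_pow_mul (by positivity [hsf.ne_zero]) hε, oddOddPrimes_mul_sq hsf.ne_zero hk,
    oddOddPrimes_of_odd_squarefree hodd hsf]

/-- **Disjointness of the supports.**  If `2^ε d k² = 2^{ε'} d' k'²` with `d, d'` odd squarefree, `k, k' ≥ 1` and
`ε, ε' ≤ 1`, then `d = d'`: both sides have the same set of odd primes with odd exponent, namely `d.primeFactors`,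
resp. `d'.primeFactors`, and a squarefree number is the product of its prime factors.  So the sets
`S_d = {d k², 2 d k² : k ≥ 1}` are pairwise disjoint for distinct odd squarefree `d`. -/
theorem eq_of_sq_or_twice_sq_eq {d d' k k' ε ε' : ℕ} (hd : Odd d) (hsd : Squarefree d) (hd' : Odd d')
    (hsd' : Squarefree d') (hk : k ≠ 0) (hk' : k' ≠ 0) (hε : ε ≤ 1) (hε' : ε' ≤ 1)
    (h : 2 ^ ε * (d * k ^ 2) = 2 ^ ε' * (d' * k' ^ 2)) : d = d' := by
  have h1 := oddOddPrimes_two_pow_mul_mul_sq hd hsd hk hε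
  rw [h, oddOddPrimes_two_pow_mul_mul_sq hd' hsd' hk' hε'] at h1
  rw [← Nat.prod_primeFactors_of_squarefree hsd, ← Nat.prod_primeFactors_of_squarefree hsd', h1]

/-- Set form of the disjointness: for distinct odd squarefree `d, d'` no `m` lies in both `S_d` and `S_{d'}`. -/
theorem not_sq_or_twice_sq_of_ne {d d' m : ℕ} (hd : Odd d) (hsd : Squarefree d) (hd' : Odd d')
    (hsd' : Squarefree d') (hne : d ≠ d')
    (hm : ∃ k, k ≠ 0 ∧ (m = d * k ^ 2 ∨ m = 2 * (d * k ^ 2))) :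
    ¬ ∃ k, k ≠ 0 ∧ (m = d' * k ^ 2 ∨ m = 2 * (d' * k ^ 2)) := by
  rintro ⟨k', hk', hm'⟩
  obtain ⟨k, hk, hmk⟩ := hm
  apply hne
  -- normalise both descriptions of `m` to the shape `2^ε · (d k²)`
  have key : ∀ {ε ε' : ℕ}, ε ≤ 1 → ε' ≤ 1 → m = 2 ^ ε * (d * k ^ 2) → m = 2 ^ ε' * (d' * k' ^ 2) → d = d' :=
    fun hε hε' h h' ↦ eq_of_sq_or_twice_sq_eq hd hsd hd' hsd' hk hk' hε hε' (h.symm.trans h')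
  rcases hmk with h | h <;> rcases hm' with h' | h'
  · exact key zero_le_one zero_le_one (by simpa using h) (by simpa using h')
  · exact key zero_le_one le_rfl (by simpa using h) (by simpa using h')
  · exact key le_rfl zero_le_one (by simpa using h) (by simpa using h')
  · exact key le_rfl le_rfl (by simpa using h) (by simpa using h')

/-! ### 3. Independence of indicator series with disjointly marked supports, in `R⟦q⟧` -/

/-- **Independence lemma.**  Let `S i ⊆ ℕ` (`i ∈ D`) be sets with marked elements `e i ∈ S i`, `e i ≠ 0`, such that
`e i ∉ S j` for `i ≠ j` in `D`.  If `Σ_{i ∈ D} r_i · 𝟙_{S i}` (as a power series `Σ_m (…) q^m` over a commutative ring `R`)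
is a constant, then every coefficient `r_i` vanishes: read off the coefficient of `q^{e i}`. -/
theorem eq_zero_of_sum_smul_indicator_eq_C {R : Type*} [CommRing R] {ι : Type*} (D : Finset ι)
    (S : ι → Set ℕ) (e : ι → ℕ) (he : ∀ i ∈ D, e i ∈ S i ∧ e i ≠ 0)
    (hsep : ∀ i ∈ D, ∀ j ∈ D, i ≠ j → e i ∉ S j) (r : ι → R) {c : R}
    (h : ∑ i ∈ D, r i • PowerSeries.mk ((S i).indicator (1 : ℕ → R)) = PowerSeries.C c) :
    ∀ i ∈ D, r i = 0 := by
  intro i hi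
  have h1 := congr_arg (PowerSeries.coeff (e i)) h
  rw [map_sum, PowerSeries.coeff_C, if_neg (he i hi).2,
    Finset.sum_eq_single i _ fun h' ↦ (h' hi).elim, map_smul, PowerSeries.coeff_mk,
    Set.indicator_of_mem (he i hi).1, Pi.one_apply, smul_eq_mul, mul_one] at h1
  · exact h1
  · intro j hj hne
    rw [map_smul, PowerSeries.coeff_mk, Set.indicator_of_notMem (hsep i hi j hj hne.symm), smul_zero]

/-! ### 4. The `θ_d` in `𝔽₂⟦q⟧` -/

/-- **Independence of the `θ_d = Σ_{k ≥ 1}(q^{d k²} + q^{2 d k²}) ∈ 𝔽₂⟦q⟧`.**  Let `D` be a finite set of odd squarefree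
numbers and `r : ℕ → ℤ`.  If `Σ_{d ∈ D} r_d θ_d` is a constant in `𝔽₂⟦q⟧` then every `r_d` (`d ∈ D`) is even — the
coefficient of `q^{d₀}` is `r_{d₀} mod 2` by the disjointness of the supports (`not_sq_or_twice_sq_of_ne`).  With
`r_d` = the `η`-exponents of a modular unit at an odd squarefree level this is the combinatorial half of the `η`-parity
lemma («`q u'/u ≡ 0 (mod 2)` iff all `r_d` are even»). -/
theorem even_of_sum_smul_theta_eq_C {D : Finset ℕ} (hD : ∀ d ∈ D, Odd d ∧ Squarefree d) (r : ℕ → ℤ)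
    {c : ZMod 2} (h : ∑ d ∈ D, (r d : ZMod 2) •
      PowerSeries.mk ({m | ∃ k, k ≠ 0 ∧ (m = d * k ^ 2 ∨ m = 2 * (d * k ^ 2))}.indicator (1 : ℕ → ZMod 2)) =
      PowerSeries.C c) :
    ∀ d ∈ D, Even (r d) := by
  have h0 := eq_zero_of_sum_smul_indicator_eq_C D
    (fun d ↦ {m | ∃ k, k ≠ 0 ∧ (m = d * k ^ 2 ∨ m = 2 * (d * k ^ 2))}) id
    (fun d hd ↦ ⟨⟨1, one_ne_zero, Or.inl (by simp)⟩, (hD d hd).2.ne_zero⟩)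
    (fun i hi j hj hne ↦ not_sq_or_twice_sq_of_ne (hD i hi).1 (hD i hi).2 (hD j hj).1 (hD j hj).2 hne
      ⟨1, one_ne_zero, Or.inl (by simp)⟩)
    (fun d ↦ (r d : ZMod 2)) h
  intro d hd
  exact even_iff_two_dvd.mpr (by exact_mod_cast (ZMod.intCast_zmod_eq_zero_iff_dvd (r d) 2).mp (h0 d hd))

/-- **`Σ_{d ∈ D} r_d θ_d` is a constant in `𝔽₂⟦q⟧` iff every `r_d` is even** (`D` a finite set of odd squarefree
numbers); the constant is then `0`. -/
theorem sum_smul_theta_eq_C_iff {D : Finset ℕ} (hD : ∀ d ∈ D, Odd d ∧ Squarefree d) (r : ℕ → ℤ) :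
    (∃ c : ZMod 2, ∑ d ∈ D, (r d : ZMod 2) •
      PowerSeries.mk ({m | ∃ k, k ≠ 0 ∧ (m = d * k ^ 2 ∨ m = 2 * (d * k ^ 2))}.indicator (1 : ℕ → ZMod 2)) =
      PowerSeries.C c) ↔ ∀ d ∈ D, Even (r d) := by
  refine ⟨fun ⟨c, h⟩ ↦ even_of_sum_smul_theta_eq_C hD r h, fun h ↦ ⟨0, ?_⟩⟩
  rw [_root_.map_zero]
  refine Finset.sum_eq_zero fun d hd ↦ ?_
  rw [(ZMod.intCast_zmod_eq_zero_iff_dvd (r d) 2).mpr (even_iff_two_dvd.mp (h d hd)), zero_smul]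

/-- The coefficientwise form actually met when reducing `q u'/u` mod `2`: for odd `d` the `m`-th coefficient of
`θ_d` equals `d·σ(m/d) mod 2` if `d ∣ m`, `m ≠ 0`, and `0` otherwise. -/
theorem indicator_sq_or_twice_sq_eq_sigma {d : ℕ} (hd : Odd d) (m : ℕ) :
    {m | ∃ k, k ≠ 0 ∧ (m = d * k ^ 2 ∨ m = 2 * (d * k ^ 2))}.indicator (1 : ℕ → ZMod 2) m =
      if d ∣ m ∧ m ≠ 0 then ((d * σ 1 (m / d) : ℕ) : ZMod 2) else 0 := by
  have hd0 : d ≠ 0 := by rintro rfl; exact Nat.not_odd_zero hd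
  by_cases hm : m ∈ {m | ∃ k, k ≠ 0 ∧ (m = d * k ^ 2 ∨ m = 2 * (d * k ^ 2))}
  · rw [Set.indicator_of_mem hm, Pi.one_apply]
    obtain ⟨hdm, hm0, hodd⟩ := (sq_or_twice_sq_iff_odd_sigma hd0).mp hm
    rw [if_pos ⟨hdm, hm0⟩, eq_comm, ZMod.natCast_eq_one_iff_odd]
    exact hd.mul hodd
  · rw [Set.indicator_of_notMem hm]
    by_cases h : d ∣ m ∧ m ≠ 0
    · rw [if_pos h, eq_comm, (ZMod.natCast_eq_zero_iff_even).mpr]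
      rw [Nat.even_mul, ← Nat.not_odd_iff_even, ← Nat.not_odd_iff_even]
      exact Or.inr fun hodd ↦ hm ((sq_or_twice_sq_iff_odd_sigma hd0).mpr ⟨h.1, h.2, hodd⟩)
    · rw [if_neg h]

end Summit.BirchSwinnertonDyer.BirchSwinnertonDyer.Theorems.DepletionAtTwo
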